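import Literature.AnabelianGeometry.SemiGraphs.TemperedCompactInVerticialAt
import HarnessLib

/-!
# [SemiAnbd] Thm 3.7 (iv) from (ii), (iii) — PER-GRAPH twin (cell ruling φ2 / α4-3 (ii))

Mochizuki, *Semi-graphs of anabelioids*, Publ. RIMS **42** (2006), §3, Theorem 3.7 (ii)–(iv), manuscript
pp. 40–41 [cite: MochizukiSemiAnbd2006, Thm 3.7(iii)(iv) pp.40-41].

PROOF-ONLY companion of `TemperedMaximalCompact.lean` (abc-iut cell wave-4 seat abc-iut-w4-d075, L3-lead
ruling α4-3 (ii)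
«φ2-CONSUMERS»): the same theorems with the ∀-countable named facts `CompactInVerticial` /
`MaximalCompactIffVerticial` / `EdgeLikeIsInfVerticial` / `EdgeLikeDistinct` replaced by their per-graph
forms `…At 𝒢` (`TemperedCompactInVerticialAt.lean`), so that the finite-`𝔾` producer
(`compactInVerticialAt_of_finiteLevelData`) feeds them; proofs ported VERBATIM with `hCV 𝒢 ↦ hCV`
(the `Thm37Hypotheses` argument stays).  Original file untouched.  No definitions, no new named fact;
nothing here asserts Thm 3.7 (iii) for an infinite `𝔾`, and nothing bears on [IUTchIII] Cor. 3.12.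
-/

namespace Literature.AnabelianGeometry.SemiGraphs

namespace ProfiniteSemiGraph

open Topology

universe u w

variable {𝒢 ℋ : ProfiniteSemiGraph.{u}}

/-- **[SemiAnbd] Thm 3.7 (iv), first sentence, from (ii) + (iii)**: the maximal compact subgroups of
`π₁^temp(G)` are precisely the verticial subgroups — a compact subgroup lies in a verticial one
((iii), first part), verticial subgroups are compact, and nested verticial subgroups coincide ((ii)).
[cite: MochizukiSemiAnbd2006, Thm 3.7(iv) p.41] -/
theorem isMaximalCompactSubgroup_iff_mem_verticialSubgroups_at (hCV : CompactInVerticialAt 𝒢)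
    (hVD : VerticialDistinct.{u}) (h𝒢 : 𝒢.Thm37Hypotheses) (c : TemperedPiChart 𝒢) (K : Subgroup c.G) :
    IsMaximalCompactSubgroup K ↔ ∃ v, K ∈ verticialSubgroups c v := by
  constructor
  · rintro ⟨hKc, hmax⟩
    obtain ⟨⟨v, H, hH, hKH⟩, -⟩ := hCV h𝒢 c K hKc
    exact ⟨v, (hmax H (isCompact_of_mem_verticialSubgroups c hH) hKH) ▸ hH⟩
  · rintro ⟨v, hK⟩
    refine ⟨isCompact_of_mem_verticialSubgroups c hK, fun K' hK'c hKK' => ?_⟩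
    obtain ⟨⟨v', H', hH', hK'H'⟩, -⟩ := hCV h𝒢 c K' hK'c
    have hKH' : K = H' := eq_of_le_of_mem_verticialSubgroups hVD h𝒢 c hK hH' (hKK'.trans hK'H')
    exact le_antisymm (hKH' ▸ hK'H') hKK'

/-- **[SemiAnbd] Thm 3.7 (iv) from (ii), (iii) and the residual `EdgeLikeIsInfVerticial`** — G10 rung 4
as a reduction: maximal compact ⇔ verticial (first sentence, unconditionally in (ii)+(iii)); a nontrivial
`L` is the intersection of two distinct maximal compact subgroups iff it is an edge-like subgroup of a
closed edge (`⇐` by the residual; `⇒`: `L = K₁ ⊓ K₂` is compact — `π₁^temp` is Hausdorff — and lies in the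
two distinct verticial subgroups `K₁`, `K₂`, so by (iii), second part, in an edge-like `L'` of a closed
edge, and `L' = H₁ ⊓ H₂` with `Hᵢ` verticial containing `L`, hence `{H₁, H₂} = {K₁, K₂}` and `L' = L`).
[cite: MochizukiSemiAnbd2006, Thm 3.7(iv) p.41] -/
theorem maximalCompactIffVerticialAt_of (hCV : CompactInVerticialAt 𝒢) (hVD : VerticialDistinct.{u})
    (hE : EdgeLikeIsInfVerticialAt 𝒢) : MaximalCompactIffVerticialAt 𝒢 := by
  intro h𝒢 c
  have hiff := isMaximalCompactSubgroup_iff_mem_verticialSubgroups_at hCV hVD h𝒢 c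
  refine ⟨hiff, fun L hL => ⟨?_, ?_⟩⟩
  · -- `⇒`: intersections of two distinct maximal compact subgroups are edge-like
    rintro ⟨K₁, K₂, hK₁, hK₂, hne, rfl⟩
    obtain ⟨v₁, hK₁v⟩ := (hiff K₁).mp hK₁
    obtain ⟨v₂, hK₂v⟩ := (hiff K₂).mp hK₂
    haveI := c.t2Space
    have hLc : IsCompact ((K₁ ⊓ K₂ : Subgroup c.G) : Set c.G) := by
      rw [Subgroup.coe_inf]
      exact hK₁.1.inter_right hK₂.1.isClosed
    obtain ⟨-, h2⟩ := hCV h𝒢 c (K₁ ⊓ K₂) hLc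
    obtain ⟨honly, e, L', he, hL', hLL'⟩ := h2 hL v₁ v₂ K₁ K₂ hK₁v hK₂v hne inf_le_left inf_le_right
    have hL'ne : L' ≠ ⊥ := fun h => hL (le_bot_iff.mp (h ▸ hLL'))
    obtain ⟨w₁, w₂, H₁, H₂, hH₁, hH₂, hH, rfl⟩ := hE h𝒢 c e he L' hL' hL'ne
    have hH₁' := honly w₁ H₁ hH₁ (hLL'.trans inf_le_left)
    have hH₂' := honly w₂ H₂ hH₂ (hLL'.trans inf_le_right)
    refine ⟨e, he, ?_⟩
    rcases hH₁' with rfl | rfl <;> rcases hH₂' with rfl | rfl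
    · exact absurd rfl hH
    · exact hL'
    · rw [inf_comm]; exact hL'
    · exact absurd rfl hH
  · -- `⇐`: edge-like subgroups of closed edges are such intersections
    rintro ⟨e, he, hLe⟩
    obtain ⟨v₁, v₂, H₁, H₂, hH₁, hH₂, hH, rfl⟩ := hE h𝒢 c e he _ hLe hL
    exact ⟨H₁, H₂, (hiff H₁).mpr ⟨v₁, hH₁⟩, (hiff H₂).mpr ⟨v₂, hH₂⟩, hH, rfl⟩

end ProfiniteSemiGraph

end Literature.AnabelianGeometry.SemiGraphs
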